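import Summits.CriticalPhenomena.SAWScalingLimit.Theorems.SAWDefectDecoherenceMassRatioRenewalDefs
import Literature.Probability.RandomPlanarGeometry.HexSAWLowerBound

/-!
# The adjacent-door return mass in a half-plane sub-domain is an arch sum (crux `MassRatio`, stmt-CriticalPhenomena-8550)

Registered sub-goal `DoorShift.doorReturn_le_of_halfPlane` (lead c2, line `flat-root-arc-swap`): for
`Λ` inside the half-lattice `{row ≥ m}`, walks between two door edges `door m p'`, `door m p` of row
`m` are Duminil-Copin–Smirnov ARCHES, so their critical spin-`0` mass is at most
`A_{T,L}(x_c) ≤ 1/cos(3π/8)` (Lemma 2 of Duminil-Copin–Smirnov, proved in the tree: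
`DuminilCopinSmirnov2012_lemma2_holds`, `stripA_le_of_lemma2`).

* `norm_Z_le_of_archChart` — the general ARCH LEMMA: if a chart `Φ : hexGraph ≃g hvGraph` sends
  the root mid-edge `{u, w₁}` (`u ∉ Λ`) onto DCS's `a = {w, O}`, the target mid-edge `{d, v}`
  (`d ∉ Λ`) onto an `α`-dart `((k,0,false), (k,-1,true))`, and `Λ` into the strip `S_{T,L}`, then
  the code `w :: Φ(γ) ++ [Φ d]` of a walk `γ : {u,w₁} → {d,v}` (`HexMidEdgeSAW.isMidWalk_code`) is,
  injectively, a walk counted by `A_{T,L}`, whence `‖F_{x_c,0}‖ = Σ_γ x_c^{ℓ(γ)} ≤ A_{T,L}(x_c)`;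
* `doorReturn_le_of_halfPlane` — the registered statement: the chart is
  `Φ = shift(-(p'-m)/2, -m) ∘ hvIso` (brick coordinates `bv`, `row` of `Negative/Brick.lean`:
  `bv m p' ↦ O`, `bv (m-1) p' ↦ w`, `bv m p ↦ (k, 0, false)`, `bv (m-1) p ↦ (k, -1, true)`), and
  `T`, `L` are chosen large (`Finset.sup` over the finite `Λ`).

Sources: H. Duminil-Copin, S. Smirnov, Ann. of Math. 175 (2012) 1653–1665 (arXiv:1007.0575), §3
(the strip `S_{T,L}`, arches `a → α`, Lemma 2). Deliberately NOT here: the door-shift inequality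
(`…FlatRootDoorShift.lean`) and any statement of the line beyond this sub-goal.
-/

noncomputable section

namespace Summit.CriticalPhenomena.SAWScalingLimit.Theorems.MassRatio.FlatRoot

open Literature.Probability.LatticeModels Literature.Probability.RandomPlanarGeometry
open Literature.Probability.RandomPlanarGeometry.SAW
open Summit.CriticalPhenomena.SAWScalingLimit.Theorems.MassRatio.Negative
open Summit.CriticalPhenomena.SAWScalingLimit.Theorems.MassRatio.Renewal (Z door)

namespace DoorShift

open Literature.Probability.RandomPlanarGeometry.SAW.HV in
/-- **Arch lemma.** Let `Φ : ℍ ≃ HV` be a chart with `Φ u = w`, `Φ w₁ = O` (`u ∉ Λ`), sending the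
target edge `{d, v}` (`d ∉ Λ`, `d ∼ v`, `{u, w₁} ≠ {d, v}`) onto the `α`-dart `(k,0,false) → (k,-1,true)`
and `Λ` into the strip `S_{T,L}` (`T ≥ 1`). Then every self-avoiding walk `{u,w₁} → {d,v}` of `Λ` is
coded, injectively and with the same length, by an arch `a → α ∖ {a}` of `S_{T,L}`, so that
`‖F_{x_c,0}({d,v})‖ = Σ_γ x_c^{ℓ(γ)} ≤ A_{T,L}(x_c) ≤ 1/cos(3π/8)` (Duminil-Copin–Smirnov 2012, §3,
Lemma 2). [folklore] -/
theorem norm_Z_le_of_archChart {Λ : Finset HexVertex} {u w₁ d v : HexVertex}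
    (Φ : hexGraph ≃g hvGraph) {k : ℤ} {T L : ℕ} (hT : 1 ≤ T) (hu : u ∉ Λ) (hd : d ∉ Λ)
    (hdv : hexGraph.Adj d v) (haz : s(u, w₁) ≠ s(d, v)) (hΦu : Φ u = wOut)
    (hΦw : Φ w₁ = hvOrigin) (hΦv : Φ v = (k, 0, false)) (hΦd : Φ d = (k, -1, true))
    (hstrip : ∀ w ∈ Λ, Φ w ∈ stripV T L) :
    ‖hexParafermionicObservable Λ s(u, w₁) hexCriticalFugacity 0 s(d, v)‖ ≤
      (Real.cos (3 * Real.pi / 8))⁻¹ := by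
  classical
  have hx0 : (0 : ℝ) ≤ hexCriticalFugacity := hexCriticalFugacity_pos_lt_one.1.le
  -- every walk is nontrivial and ends at `v` (the other endpoint `d` is off `Λ`)
  have hne : ∀ γ : HexMidEdgeSAW Λ s(u, w₁) s(d, v), γ.verts ≠ [] :=
    fun γ h => haz (γ.eq_of_nil h)
  have hlast : ∀ γ : HexMidEdgeSAW Λ s(u, w₁) s(d, v), γ.verts.getLast (hne γ) = v := by
    intro γ
    rcases γ.getLast_eq_or (hne γ) with h | h
    · exact absurd (h ▸ γ.subset _ (List.getLast_mem (hne γ))) hd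
    · exact h
  -- the code of a walk: an arch of the strip
  set code : HexMidEdgeSAW Λ s(u, w₁) s(d, v) → List HV :=
    fun γ => wOut :: (γ.verts.map Φ ++ [Φ d]) with hcode
  have hmid : ∀ γ, IsMidWalk (stripV T L) (code γ) := by
    intro γ
    have h := HexMidEdgeSAW.isMidWalk_code Φ γ rfl hu hΦu hΦw hdv (hne γ)
      (Or.inr ⟨hlast γ, rfl⟩)
    refine h.mono ?_
    intro y hy
    obtain ⟨w, hw, rfl⟩ := Finset.mem_map.1 hy
    exact hstrip w hw
  have halpha : ∀ γ, IsAlphaDart (finalDart (code γ)) := by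
    intro γ
    have hne' : γ.verts.map Φ ≠ [] := by simpa using hne γ
    simp only [hcode]
    rw [finalDart_cons_append hne', List.getLast_map hne', hlast γ, hΦv, hΦd]
    exact ⟨rfl, rfl, rfl⟩
  have hmem : ∀ γ ∈ (Finset.univ : Finset (HexMidEdgeSAW Λ s(u, w₁) s(d, v))),
      code γ ∈ (midWalks (stripV T L)).filter (fun P => IsAlphaDart (finalDart P)) :=
    fun γ _ => Finset.mem_filter.2 ⟨mem_midWalks_iff.2 (hmid γ), halpha γ⟩
  have hinj : Set.InjOn code
      (↑(Finset.univ : Finset (HexMidEdgeSAW Λ s(u, w₁) s(d, v))) : Set _) := by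
    intro γ₁ _ γ₂ _ h
    simp only [hcode] at h
    have h1 := List.cons_injective h
    have h2 := List.append_cancel_right h1
    exact HexMidEdgeSAW.ext ((List.map_injective_iff.2 Φ.injective) h2)
  have hlen : ∀ γ : HexMidEdgeSAW Λ s(u, w₁) s(d, v), mwLen (code γ) = γ.length := by
    intro γ; simp only [hcode]; rw [mwLen_cons_append, List.length_map]; rfl
  -- compare with `A_{T,L}(x_c) ≤ 1/cos(3π/8)`
  calc ‖hexParafermionicObservable Λ s(u, w₁) hexCriticalFugacity 0 s(d, v)‖
      = ∑ γ : HexMidEdgeSAW Λ s(u, w₁) s(d, v), hexCriticalFugacity ^ γ.length :=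
        norm_Z_eq_sum _ _ _ hx0
    _ = ∑ γ : HexMidEdgeSAW Λ s(u, w₁) s(d, v), hexCriticalFugacity ^ mwLen (code γ) :=
        Finset.sum_congr rfl fun γ _ => by rw [hlen]
    _ ≤ ∑ P ∈ (midWalks (stripV T L)).filter (fun P => IsAlphaDart (finalDart P)),
          hexCriticalFugacity ^ mwLen P :=
        sum_le_sum_of_injOn_of_nonneg code hinj hmem (fun P => hexCriticalFugacity ^ mwLen P)
          fun _ _ => pow_nonneg hx0 _
    _ = stripA T L hexCriticalFugacity := rfl
    _ ≤ (Real.cos (3 * Real.pi / 8))⁻¹ :=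
        stripA_le_of_lemma2 DuminilCopinSmirnov2012_lemma2_holds hT L

open Literature.Probability.RandomPlanarGeometry.SAW.HV in
/-- **Arch bound for the door-to-door mass (registered sub-goal).** If every vertex of `Λ` has row
`≥ m`, then for two distinct door positions `p ≠ p'` of row `m` (parities `(p-m) % 2 = (p'-m) % 2 = 0`),
`Z_Λ(door m p' → door m p) ≤ 1/cos(3π/8)`: in the chart `Φ = shift(-(p'-m)/2, -m) ∘ hvIso` the
walks are arches of a DCS strip `S_{T,L}` (`norm_Z_le_of_archChart`). -/
theorem doorReturn_le_of_halfPlane : ∀ (Λ : Finset HexVertex) (m p p' : ℤ), (∀ v ∈ Λ, m ≤ row v) → (p - m) % 2 = 0 → (p' - m) % 2 = 0 → p ≠ p' → bv m p' ∈ Λ → Z Λ (door m p') (door m p) ≤ (Real.cos (3 * Real.pi / 8))⁻¹ := by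
  intro Λ m p p' hΛ hp hp' hpp hw₁
  -- the chart `Φ = shift (-(p'-m)/2, -m) ∘ hvIso`, in coordinates and on brick vertices
  obtain ⟨Φ, hΦ⟩ : ∃ Φ : hexGraph ≃g hvGraph, ∀ y : HexVertex,
      Φ y = (y.1 0 - (p' - m) / 2, y.1 1 - m, decide (y.2 = 1)) := by
    refine ⟨hvIso.trans (shift (-((p' - m) / 2)) (-m)), ?_⟩
    rintro ⟨c, i⟩
    show shift (-((p' - m) / 2)) (-m) (toHV (c, i)) = _
    simp only [toHV, shift_apply]
    refine Prod.ext ?_ (Prod.ext ?_ rfl) <;> dsimp only <;> omega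
  have hΦeven : ∀ r q : ℤ, (q - r) % 2 = 0 →
      Φ (bv r q) = ((q - r) / 2 - (p' - m) / 2, r - m, false) := fun r q h => by
    rw [hΦ]; simp [bv, h]
  have hΦodd : ∀ r q : ℤ, (q - r) % 2 = 1 →
      Φ (bv r q) = ((q - r - 1) / 2 - (p' - m) / 2, r - m, true) := fun r q h => by
    rw [hΦ]; simp [bv, h]
  -- a strip `S_{T,L}` containing `Φ(Λ)`
  obtain ⟨T, hT1, hT⟩ : ∃ T : ℕ, 1 ≤ T ∧ ∀ w ∈ Λ, row w - m + 1 ≤ T := by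
    refine ⟨Λ.sup fun w => (row w - m + 1).toNat, ?_, fun w hw => ?_⟩
    · have h1 : (row (bv m p') - m + 1).toNat ≤ Λ.sup (fun w => (row w - m + 1).toNat) :=
        Finset.le_sup (f := fun w => (row w - m + 1).toNat) hw₁
      rw [row_bv] at h1
      omega
    · have h1 : (row w - m + 1).toNat ≤ Λ.sup (fun w => (row w - m + 1).toNat) :=
        Finset.le_sup (f := fun w => (row w - m + 1).toNat) hw
      omega
  obtain ⟨L, hL⟩ : ∃ L : ℕ, ∀ w ∈ Λ, (w.1 0 - (p' - m) / 2).natAbs ≤ L :=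
    ⟨Λ.sup fun w => (w.1 0 - (p' - m) / 2).natAbs, fun w hw =>
      Finset.le_sup (f := fun w => (w.1 0 - (p' - m) / 2).natAbs) hw⟩
  show ‖hexParafermionicObservable Λ s(bv (m - 1) p', bv m p') hexCriticalFugacity 0
    s(bv (m - 1) p, bv m p)‖ ≤ _
  refine norm_Z_le_of_archChart Φ (k := (p - m) / 2 - (p' - m) / 2) (T := T) (L := L) hT1
    ?_ ?_ ?_ ?_ ?_ ?_ ?_ ?_ ?_
  · intro h; have := hΛ _ h; rw [row_bv] at this; omega
  · intro h; have := hΛ _ h; rw [row_bv] at this; omega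
  · exact (adj_bv_iff _ _ _ _).2 (Or.inr (Or.inr ⟨rfl, by ring, by omega⟩))
  · intro h
    rcases Sym2.eq_iff.1 h with ⟨-, h1⟩ | ⟨h1, -⟩
    · exact hpp (bv_inj h1).2.symm
    · have := (bv_inj h1).1; omega
  · rw [hΦodd _ _ (by omega)]; unfold wOut
    refine Prod.ext ?_ (Prod.ext ?_ rfl) <;> dsimp only <;> omega
  · rw [hΦeven _ _ hp']; unfold hvOrigin
    refine Prod.ext ?_ (Prod.ext ?_ rfl) <;> dsimp only <;> omega
  · rw [hΦeven _ _ hp]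
    refine Prod.ext rfl (Prod.ext ?_ rfl); dsimp only; omega
  · rw [hΦodd _ _ (by omega)]
    refine Prod.ext ?_ (Prod.ext ?_ rfl) <;> dsimp only <;> omega
  · intro w hw
    have h1 := hT w hw
    have h2 := hL w hw
    have h3 := hΛ w hw
    unfold row at h1 h3
    rw [hΦ w, mem_stripV_iff]
    generalize decide (w.2 = 1) = β
    cases β <;> simp only [lev_mk, bit_true, bit_false] <;> omega

end DoorShift

end Summit.CriticalPhenomena.SAWScalingLimit.Theorems.MassRatio.FlatRoot
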